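import Literature.Analysis.FunctionSpaces.LittlewoodPaleyProofs
import Literature.Analysis.UnboundedOperators.HeatKernelLpSmoothingProofs
import Mathlib.Analysis.Fourier.Convolution
import HarnessLib

/-!
# Discharged facts: Bernstein's inequality and the Besov embedding `Ḃ^s_{p,q} ↪ Ḃ^{s-d(1/p-1/r)}_{r,q}`

`Literature.Analysis.FunctionSpaces.LittlewoodPaley` records as named facts (`Prop`-valued `def`s)
the support properties of the dyadic symbols `φ_j` (Bahouri–Chemin–Danchin 2011, Prop. 2.10) and
the Besov embedding (BCD Prop. 2.20, "Bernstein's inequality on each block"). This file proves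

* `Literature.dyadicSymbol_apply_of_norm_le_holds : dyadicSymbol_apply_of_norm_le` and
  `Literature.dyadicSymbol_apply_of_le_norm_holds : dyadicSymbol_apply_of_le_norm` — `φ_j(ξ) = 0` for
  `‖ξ‖ ≤ 2^{j-1}` and for `2^{j+1} ≤ ‖ξ‖` (both cut-offs are `1`, resp. `0`, there);
* `Literature.Analysis.FunctionSpaces.exists_eLpNormDistrib_lpBlock_le` — **Bernstein's inequality on the dyadic blocks**
  (BCD Lemma 2.1 with `k = 0`, `λ = 2^j`): for `1 ≤ p ≤ r ≤ ∞` there is `C` with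
  `‖Δ̇_j u‖_{L^r} ≤ C 2^{j d (1/p - 1/r)} ‖Δ̇_j u‖_{L^p}` for all `j ∈ ℤ`, `u ∈ 𝓢'(E, F)`
  (`d = dim E`; when `Δ̇_j u ∉ L^p` the right-hand side is `∞` — `Literature.Analysis.FunctionSpaces.eLpNormDistrib`, `C ≠ 0` —
  and the bound is vacuous; the left-hand side may well be finite for `r ≠ p`);
* `Literature.besov_embedding_holds : besov_embedding` (BCD Prop. 2.20) and its class-level form
  `Literature.MemHomBesov.of_exponent_le_holds : MemHomBesov.of_exponent_le`.

## Proof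

The argument is BCD's proof of Lemma 2.1 ("`û = ψ û` for a `ψ ∈ 𝓓` equal to `1` near the
annulus, so `u = (𝓕⁻¹ψ) ⋆ u`, and Young's inequality"), organised as follows.

* `§ Young`, `§ HolderConv`, `§ KernelBound`: Young's inequality `‖K ⋆ f‖_p ≤ ‖K‖₁ ‖f‖_p` for a
  scalar kernel with values in a normed field `𝕜` acting by `lsmul 𝕜 𝕜` (the real-kernel version
  is `Literature.Analysis.UnboundedOperators.eLpNorm_convolution_le_lintegral_enorm_mul` of `HeatKernel.lean`; the proof is repeated
  verbatim for `𝕜`-valued kernels, which the complex-valued Bernstein kernel requires), the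
  pointwise Hölder bound `‖(K ⋆ f)(x)‖ ≤ ‖K‖_{p'} ‖f‖_p`, and — interpolating the two with
  `Literature.Analysis.UnboundedOperators.eLpNorm_le_eLpNorm_rpow_mul_eLpNorm_top_rpow` — the bound
  `‖K ⋆ f‖_{L^r} ≤ ‖K‖₁^{p/r} ‖K‖_{p'}^{1-p/r} ‖f‖_{L^p}` for `K ∈ L¹ ∩ L^{p'}`, `p ≤ r ≤ ∞`
  (`Literature.Analysis.FunctionSpaces.exists_eLpNorm_convolution_smul_le`).
* `§ SchwartzFourier`, `§ MultiplierConvolution`: **Fourier multipliers with Schwartz symbol act on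
  `L^p` by convolution**: for `Ψ ∈ 𝓢(E, ℂ)`, `f ∈ L^p(E; F)` (`1 ≤ p ≤ ∞`) and a test function `u`,
  `⟨Ψ(D) f, u⟩ = ∫ u(y) • ((𝓕⁻Ψ) ⋆ f)(y) dy`
  (`Literature.Analysis.FunctionSpaces.fourierMultiplierCLM_coe_apply_eq_integral_convolution`). At the Schwartz level this is
  the convolution theorem `𝓕(Ψ · 𝓕⁻u) = u ⋆ 𝓕Ψ` (Mathlib's `SchwartzMap.fourier_convolution`);
  the passage to `f ∈ L^p` is Fubini, the integrand `(u(y) 𝓕Ψ(x-y)) • f(x)` being integrable on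
  `E × E` by Hölder (`‖𝓕Ψ(· - y)‖_{p'} ‖f‖_p`, uniformly in `y`) and the integrability of `u`.
* `§ Symbols`: the support facts for `φ_j`, and the *reproducing symbol*
  `ψ = χ(·/2) - χ(4·) = Ṡ₁ - Ṡ₋₂`-symbol (`Literature.Analysis.FunctionSpaces.bernsteinSymbol`), smooth, compactly supported,
  equal to `1` on `1/2 ≤ ‖ξ‖ ≤ 2 ⊇ {φ₀ ≠ 0}`, whence `Δ̇₀ = ψ(D) Δ̇₀`
  (`Literature.Analysis.FunctionSpaces.lpBlock_zero_eq_fourierMultiplierCLM_bernsteinSymbol`).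
* `§ Bernstein`: with the Bernstein kernel `h = 𝓕⁻ψ ∈ 𝓢(E, ℂ)` (`Literature.Analysis.FunctionSpaces.bernsteinKernel`), if
  `Δ̇₀ v = f ∈ L^p` then `Δ̇₀ v = ψ(D) f = h ⋆ f ∈ L^r` with `‖h ⋆ f‖_r ≤ C ‖f‖_p`
  (`Literature.Analysis.FunctionSpaces.exists_eLpNormDistrib_lpBlock_zero_le`); the general block `Δ̇_j` follows by the dyadic
  scaling `Δ̇_j u = (Δ̇₀ (u(2^{-j}·)))(2^j ·)` and `‖w(2^j ·)‖_{L^p} = 2^{-jd/p} ‖w‖_{L^p}` of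
  `LittlewoodPaleyProofs.lean` (`Literature.Analysis.FunctionSpaces.lpBlock_distribDilate_holds`, `Literature.Analysis.FunctionSpaces.eLpNormDistrib_distribDilate`);
  multiplying by the weights `2^{j(s - d(1/p - 1/r))}` and using the monotonicity/homogeneity of
  Mathlib's `eLpNorm` for the counting measure on `ℤ` gives the embedding.

## References

* H. Bahouri, J.-Y. Chemin, R. Danchin, *Fourier Analysis and Nonlinear Partial Differential
  Equations*, Grundlehren 343, Springer (2011), doi:10.1007/978-3-642-16830-7, Prop. 2.10
  (dyadic partition), Lemma 2.1 (Bernstein), Prop. 2.20 (Besov embedding).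
  [cite: BahouriCheminDanchin2011, Lemma 2.1 and Prop. 2.20]
-/

open MeasureTheory FourierTransform RealInnerProductSpace TemperedDistribution Filter Topology
open scoped SchwartzMap ENNReal NNReal Convolution

noncomputable section

namespace Literature.Analysis.FunctionSpaces

/-! ## Young's inequality `L¹ × Lᵖ → Lᵖ` for scalar kernels with values in a normed field -/

section Young

variable {𝕜 : Type*} [NontriviallyNormedField 𝕜] {G : Type*} [MeasurableSpace G] [AddGroup G]
  {μ : Measure G} {F : Type*} [NormedAddCommGroup F] [NormedSpace ℝ F] [NormedSpace 𝕜 F]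

/-- Pointwise bound `‖(K ⋆ f)(x)‖ ≤ ∫ ‖K(y)‖ ‖f(x - y)‖ dy` (in `ℝ≥0∞`, unconditionally), for a
scalar kernel `K` with values in a normed field `𝕜` acting on `F` by `lsmul 𝕜 𝕜`
(the `𝕜`-valued twin of `Literature.Analysis.UnboundedOperators.enorm_convolution_lsmul_le`). [folklore] -/
theorem enorm_convolution_smul_le (K : G → 𝕜) (f : G → F) (x : G) :
    ‖(K ⋆[ContinuousLinearMap.lsmul 𝕜 𝕜, μ] f) x‖ₑ ≤ ∫⁻ y, ‖K y‖ₑ * ‖f (x - y)‖ₑ ∂μ := by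
  rw [convolution_def]
  refine (enorm_integral_le_lintegral_enorm _).trans_eq ?_
  simp_rw [ContinuousLinearMap.lsmul_apply, enorm_smul]

variable [MeasurableAdd₂ G] [MeasurableNeg G] [SFinite μ] [μ.IsAddRightInvariant]

/-- Young's inequality `L¹ × Lᵖ → Lᵖ`, `1 ≤ p < ∞`, in `lintegral` form, for `𝕜`-valued kernels:
`∫ ‖K ⋆ f‖^p ≤ (∫ ‖K‖)^p ∫ ‖f‖^p` (Hölder against the measure `‖K‖ dy`, Tonelli, and the right
invariance of `μ`; the `𝕜`-valued twin of `Literature.Analysis.UnboundedOperators.lintegral_rpow_enorm_convolution_le`). [folklore] -/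
theorem lintegral_rpow_enorm_convolution_smul_le {K : G → 𝕜} (hK : AEStronglyMeasurable K μ)
    {f : G → F} (hf : AEStronglyMeasurable f μ) {p : ℝ} (hp : 1 ≤ p) :
    ∫⁻ x, ‖(K ⋆[ContinuousLinearMap.lsmul 𝕜 𝕜, μ] f) x‖ₑ ^ p ∂μ ≤
      (∫⁻ y, ‖K y‖ₑ ∂μ) ^ p * ∫⁻ x, ‖f x‖ₑ ^ p ∂μ := by
  have hp0 : 0 < p := one_pos.trans_le hp
  set A := ∫⁻ y, ‖K y‖ₑ ∂μ with hA
  have hKm : AEMeasurable (fun y => ‖K y‖ₑ) μ := hK.enorm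
  have hfm2 : AEMeasurable (fun z : G × G => ‖f (z.1 - z.2)‖ₑ ^ p) (μ.prod μ) :=
    (hf.comp_quasiMeasurePreserving
      (quasiMeasurePreserving_sub_of_right_invariant μ μ)).enorm.pow_const _
  have hfm1 : ∀ x, AEMeasurable (fun y => ‖f (x - y)‖ₑ) μ := fun x =>
    (hf.comp_quasiMeasurePreserving
      (quasiMeasurePreserving_sub_left_of_right_invariant μ x)).enorm
  have hfm3 : ∀ y, AEMeasurable (fun x => ‖f (x - y)‖ₑ ^ p) μ := fun y =>
    (hf.comp_quasiMeasurePreserving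
      (measurePreserving_sub_right μ y).quasiMeasurePreserving).enorm.pow_const _
  have hG : AEMeasurable (fun z : G × G => ‖K z.2‖ₑ * ‖f (z.1 - z.2)‖ₑ ^ p) (μ.prod μ) :=
    hKm.comp_snd.mul hfm2
  calc ∫⁻ x, ‖(K ⋆[ContinuousLinearMap.lsmul 𝕜 𝕜, μ] f) x‖ₑ ^ p ∂μ
      ≤ ∫⁻ x, (∫⁻ y, ‖K y‖ₑ * ‖f (x - y)‖ₑ ∂μ) ^ p ∂μ :=
        lintegral_mono fun x =>
          ENNReal.rpow_le_rpow (enorm_convolution_smul_le K f x) hp0.le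
    _ ≤ ∫⁻ x, A ^ (p - 1) * ∫⁻ y, ‖K y‖ₑ * ‖f (x - y)‖ₑ ^ p ∂μ ∂μ :=
        lintegral_mono fun x => UnboundedOperators.lintegral_mul_rpow_le_of_one_le hKm (hfm1 x) hp
    _ = A ^ (p - 1) * ∫⁻ y, ∫⁻ x, ‖K y‖ₑ * ‖f (x - y)‖ₑ ^ p ∂μ ∂μ := by
        rw [lintegral_const_mul'' _ hG.lintegral_prod_right', lintegral_lintegral_swap hG]
    _ = A ^ (p - 1) * ∫⁻ y, ‖K y‖ₑ * ∫⁻ x, ‖f x‖ₑ ^ p ∂μ ∂μ := by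
        congr 1
        refine lintegral_congr fun y => ?_
        rw [lintegral_const_mul'' _ (hfm3 y), lintegral_sub_right_eq_self (fun x => ‖f x‖ₑ ^ p) y]
    _ = A ^ p * ∫⁻ x, ‖f x‖ₑ ^ p ∂μ := by
        rw [lintegral_mul_const'' _ hKm, ← mul_assoc, ← hA]
        congr 1
        conv_rhs => rw [← sub_add_cancel p 1, ENNReal.rpow_add_of_nonneg _ _ (by linarith)
          zero_le_one, ENNReal.rpow_one]

/-- Young's inequality `L¹ × L^∞ → L^∞` for `𝕜`-valued kernels: `‖K ⋆ f‖_∞ ≤ ‖K‖₁ ‖f‖_∞`. [folklore] -/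
theorem eLpNormEssSup_convolution_smul_le {K : G → 𝕜} (hK : AEStronglyMeasurable K μ)
    (f : G → F) :
    eLpNormEssSup (K ⋆[ContinuousLinearMap.lsmul 𝕜 𝕜, μ] f) μ ≤
      (∫⁻ y, ‖K y‖ₑ ∂μ) * eLpNormEssSup f μ := by
  refine eLpNormEssSup_le_of_ae_enorm_bound (Eventually.of_forall fun x => ?_)
  refine (enorm_convolution_smul_le K f x).trans ?_
  calc ∫⁻ y, ‖K y‖ₑ * ‖f (x - y)‖ₑ ∂μ ≤ ∫⁻ y, ‖K y‖ₑ * eLpNormEssSup f μ ∂μ := by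
        apply lintegral_mono_ae
        filter_upwards [(quasiMeasurePreserving_sub_left_of_right_invariant μ x).ae
          (enorm_ae_le_eLpNormEssSup f μ)] with y hy
        gcongr
    _ = (∫⁻ y, ‖K y‖ₑ ∂μ) * eLpNormEssSup f μ := lintegral_mul_const'' _ hK.enorm

/-- **Young's inequality** `L¹ × Lᵖ → Lᵖ` for a `𝕜`-valued kernel acting by scalar
multiplication: `‖K ⋆ f‖_p ≤ ‖K‖₁ ‖f‖_p` for `1 ≤ p ≤ ∞`. [folklore] -/
theorem eLpNorm_convolution_smul_le {K : G → 𝕜} (hK : AEStronglyMeasurable K μ)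
    {f : G → F} (hf : AEStronglyMeasurable f μ) {p : ℝ≥0∞} (hp : 1 ≤ p) :
    eLpNorm (K ⋆[ContinuousLinearMap.lsmul 𝕜 𝕜, μ] f) p μ ≤
      (∫⁻ y, ‖K y‖ₑ ∂μ) * eLpNorm f p μ := by
  rcases eq_or_ne p ∞ with rfl | hptop
  · simpa using eLpNormEssSup_convolution_smul_le hK f
  have hp0 : p ≠ 0 := (zero_lt_one.trans_le hp).ne'
  have hp' : 1 ≤ p.toReal := by
    simpa using (ENNReal.toReal_le_toReal ENNReal.one_ne_top hptop).2 hp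
  have hp0' : 0 < p.toReal := one_pos.trans_le hp'
  rw [eLpNorm_eq_lintegral_rpow_enorm_toReal hp0 hptop,
    eLpNorm_eq_lintegral_rpow_enorm_toReal hp0 hptop]
  calc (∫⁻ x, ‖(K ⋆[ContinuousLinearMap.lsmul 𝕜 𝕜, μ] f) x‖ₑ ^ p.toReal ∂μ) ^ (1 / p.toReal)
      ≤ ((∫⁻ y, ‖K y‖ₑ ∂μ) ^ p.toReal * ∫⁻ x, ‖f x‖ₑ ^ p.toReal ∂μ) ^ (1 / p.toReal) :=
        ENNReal.rpow_le_rpow (lintegral_rpow_enorm_convolution_smul_le hK hf hp')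
          (by positivity)
    _ = (∫⁻ y, ‖K y‖ₑ ∂μ) * (∫⁻ x, ‖f x‖ₑ ^ p.toReal ∂μ) ^ (1 / p.toReal) := by
        rw [ENNReal.mul_rpow_of_nonneg _ _ (by positivity), ← ENNReal.rpow_mul,
          mul_one_div_cancel hp0'.ne', ENNReal.rpow_one]

/-- The convolution of an integrable `𝕜`-valued kernel with an `Lᵖ` function, `1 ≤ p ≤ ∞`, is
in `Lᵖ` (Young). [folklore] -/
theorem memLp_convolution_smul {K : G → 𝕜} (hK : Integrable K μ) {f : G → F} {p : ℝ≥0∞}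
    (hf : MemLp f p μ) (hp : 1 ≤ p) :
    MemLp (K ⋆[ContinuousLinearMap.lsmul 𝕜 𝕜, μ] f) p μ := by
  refine ⟨(hK.aestronglyMeasurable.convolution_integrand (ContinuousLinearMap.lsmul 𝕜 𝕜)
    hf.aestronglyMeasurable).integral_prod_right', ?_⟩
  refine (eLpNorm_convolution_smul_le hK.aestronglyMeasurable hf.aestronglyMeasurable hp).trans_lt ?_
  exact ENNReal.mul_lt_top hK.hasFiniteIntegral hf.eLpNorm_lt_top

/-- The convolution of a measurable `𝕜`-valued kernel with a measurable function is
a.e.-strongly measurable (Fubini). [folklore] -/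
theorem aestronglyMeasurable_convolution_smul {K : G → 𝕜} (hK : AEStronglyMeasurable K μ)
    {f : G → F} (hf : AEStronglyMeasurable f μ) :
    AEStronglyMeasurable (K ⋆[ContinuousLinearMap.lsmul 𝕜 𝕜, μ] f) μ :=
  (hK.convolution_integrand (ContinuousLinearMap.lsmul 𝕜 𝕜) hf).integral_prod_right'

end Young

/-! ## Hölder: `L^{p'} × Lᵖ → L^∞` pointwise, and the `Lᵖ → L^r` bound for `L¹ ∩ L^{p'}` kernels -/

section HolderConv

variable {𝕜 : Type*} [NontriviallyNormedField 𝕜] {G : Type*} [MeasurableSpace G]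
  [AddCommGroup G] [MeasurableAdd₂ G] [MeasurableNeg G]
  {μ : Measure G} [μ.IsAddLeftInvariant] [μ.IsNegInvariant]
  {F : Type*} [NormedAddCommGroup F] [NormedSpace ℝ F] [NormedSpace 𝕜 F]

/-- Hölder's inequality for the convolution, pointwise: `‖(K ⋆ f)(x)‖ ≤ ‖K‖_{L^q} ‖f‖_{L^p}`
whenever `1/p + 1/q = 1` (on an abelian group with a left- and negation-invariant measure, so
that `‖K(x - ·)‖_{L^q} = ‖K‖_{L^q}`; `𝕜`-valued twin of
`Literature.Analysis.UnboundedOperators.enorm_convolution_lsmul_le_eLpNorm_mul_eLpNorm`). [folklore] -/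
theorem enorm_convolution_smul_le_eLpNorm_mul {K : G → 𝕜} (hK : AEStronglyMeasurable K μ)
    {f : G → F} (hf : AEStronglyMeasurable f μ) (p q : ℝ≥0∞) [q.HolderConjugate p]
    (x : G) :
    ‖(K ⋆[ContinuousLinearMap.lsmul 𝕜 𝕜, μ] f) x‖ₑ ≤ eLpNorm K q μ * eLpNorm f p μ := by
  rw [convolution_lsmul_swap]
  refine (enorm_integral_le_lintegral_enorm _).trans ?_
  have hKx : AEStronglyMeasurable (fun t => K (x - t)) μ :=
    hK.comp_measurePreserving (Measure.measurePreserving_sub_left μ x)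
  calc ∫⁻ t, ‖K (x - t) • f t‖ₑ ∂μ = eLpNorm (fun t => K (x - t) • f t) 1 μ := by
        rw [eLpNorm_one_eq_lintegral_enorm]
    _ ≤ eLpNorm (fun t => K (x - t)) q μ * eLpNorm f p μ :=
        eLpNorm_smul_le_mul_eLpNorm hf hKx
    _ = eLpNorm K q μ * eLpNorm f p μ := by
        rw [eLpNorm_comp_measurePreserving (g := K) hK (Measure.measurePreserving_sub_left μ x)
          |>.symm]
        rfl

variable [SFinite μ] [μ.IsAddRightInvariant]

/-- **Young + Hölder + interpolation**: a kernel `K ∈ L¹ ∩ L^{p'}` convolves `L^p` boundedly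
into `L^r` for every `r ≥ p`: `‖K ⋆ f‖_{L^r} ≤ ‖K‖₁^{p/r} ‖K‖_{p'}^{1-p/r} ‖f‖_{L^p}` (the case of
Young's inequality `L^m × L^p → L^r`, `1 + 1/r = 1/m + 1/p`, that Bernstein's lemma needs,
obtained by interpolating the endpoints `m = 1`, `r = p` and `m = p'`, `r = ∞` with
`Literature.Analysis.UnboundedOperators.eLpNorm_le_eLpNorm_rpow_mul_eLpNorm_top_rpow`; BCD, proof of Lemma 2.1: "Young's inequality").
The constant is returned as a finite `C : ℝ≥0`. [folklore] -/
theorem exists_eLpNorm_convolution_smul_le {K : G → 𝕜} (hK : AEStronglyMeasurable K μ)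
    {p q r : ℝ≥0∞} [p.HolderConjugate q] (hK1 : eLpNorm K 1 μ < ∞)
    (hKq : eLpNorm K q μ < ∞) (hpr : p ≤ r) :
    ∃ C : ℝ≥0, ∀ f : G → F, AEStronglyMeasurable f μ →
      eLpNorm (K ⋆[ContinuousLinearMap.lsmul 𝕜 𝕜, μ] f) r μ ≤ C * eLpNorm f p μ := by
  have hp0 : p ≠ 0 := ENNReal.HolderConjugate.ne_zero p q
  set θ : ℝ := p.toReal / r.toReal with hθ
  have hθ0 : 0 ≤ θ := by positivity
  have hθ1 : 0 ≤ 1 - θ := by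
    rw [sub_nonneg, hθ]
    rcases eq_or_ne r ∞ with rfl | hr
    · simp
    · exact div_le_one_of_le₀
        ((ENNReal.toReal_le_toReal (ne_top_of_le_ne_top hr hpr) hr).2 hpr) ENNReal.toReal_nonneg
  have hCtop : eLpNorm K 1 μ ^ θ * eLpNorm K q μ ^ (1 - θ) ≠ ∞ :=
    ENNReal.mul_ne_top (ENNReal.rpow_ne_top_of_nonneg hθ0 hK1.ne)
      (ENNReal.rpow_ne_top_of_nonneg hθ1 hKq.ne)
  refine ⟨(eLpNorm K 1 μ ^ θ * eLpNorm K q μ ^ (1 - θ)).toNNReal, fun f hf => ?_⟩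
  rw [ENNReal.coe_toNNReal hCtop]
  have hY : eLpNorm (K ⋆[ContinuousLinearMap.lsmul 𝕜 𝕜, μ] f) p μ ≤ eLpNorm K 1 μ * eLpNorm f p μ := by
    rw [eLpNorm_one_eq_lintegral_enorm]
    exact eLpNorm_convolution_smul_le hK hf (ENNReal.HolderConjugate.one_le p q)
  have hH : eLpNorm (K ⋆[ContinuousLinearMap.lsmul 𝕜 𝕜, μ] f) ∞ μ ≤ eLpNorm K q μ * eLpNorm f p μ := by
    rw [eLpNorm_exponent_top]
    exact eLpNormEssSup_le_of_ae_enorm_bound (Eventually.of_forall fun x =>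
      enorm_convolution_smul_le_eLpNorm_mul hK hf p q x)
  calc eLpNorm (K ⋆[ContinuousLinearMap.lsmul 𝕜 𝕜, μ] f) r μ
      ≤ eLpNorm (K ⋆[ContinuousLinearMap.lsmul 𝕜 𝕜, μ] f) p μ ^ θ *
          eLpNorm (K ⋆[ContinuousLinearMap.lsmul 𝕜 𝕜, μ] f) ∞ μ ^ (1 - θ) :=
        UnboundedOperators.eLpNorm_le_eLpNorm_rpow_mul_eLpNorm_top_rpow (aestronglyMeasurable_convolution_smul hK hf)
          hp0 hpr
    _ ≤ (eLpNorm K 1 μ * eLpNorm f p μ) ^ θ * (eLpNorm K q μ * eLpNorm f p μ) ^ (1 - θ) :=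
        mul_le_mul' (ENNReal.rpow_le_rpow hY hθ0) (ENNReal.rpow_le_rpow hH hθ1)
    _ = eLpNorm K 1 μ ^ θ * eLpNorm K q μ ^ (1 - θ) *
          (eLpNorm f p μ ^ θ * eLpNorm f p μ ^ (1 - θ)) := by
        rw [ENNReal.mul_rpow_of_nonneg _ _ hθ0, ENNReal.mul_rpow_of_nonneg _ _ hθ1]
        ring
    _ = eLpNorm K 1 μ ^ θ * eLpNorm K q μ ^ (1 - θ) * eLpNorm f p μ := by
        rw [← ENNReal.rpow_add_of_nonneg _ _ hθ0 hθ1, show θ + (1 - θ) = (1 : ℝ) by ring,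
          ENNReal.rpow_one]

end HolderConv

/-! ## Schwartz-level Fourier identities -/

section SchwartzFourier

variable {V : Type*} [NormedAddCommGroup V] [InnerProductSpace ℝ V] [FiniteDimensional ℝ V]
  [MeasurableSpace V] [BorelSpace V]

/-- `𝓕 𝓕 g = g(-·)` for a Schwartz function `g` (Fourier inversion and `𝓕⁻ = 𝓕 ∘ (-·)`). [folklore] -/
theorem fourier_fourier_apply (g : 𝓢(V, ℂ)) (ξ : V) : (𝓕 (𝓕 g)) ξ = g (-ξ) := by
  have h1 : ((𝓕⁻ (𝓕 g) : 𝓢(V, ℂ)) : V → ℂ) (-ξ) = g (-ξ) := by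
    rw [FourierTransform.fourierInv_fourier_eq]
  rw [← h1, SchwartzMap.fourierInv_coe, Real.fourierInv_eq_fourier_neg, neg_neg]
  rfl

/-- `(𝓕⁻ u)(-ξ) = (𝓕 u)(ξ)` for a Schwartz function `u`. [folklore] -/
theorem fourierInv_apply_neg (u : 𝓢(V, ℂ)) (ξ : V) :
    ((𝓕⁻ u : 𝓢(V, ℂ)) : V → ℂ) (-ξ) = (𝓕 u) ξ := by
  rw [SchwartzMap.fourierInv_coe, Real.fourierInv_eq_fourier_neg, neg_neg]
  rfl

/-- `(𝓕⁻ Ψ)(z) = (𝓕 Ψ)(-z)` for a Schwartz function `Ψ`. [folklore] -/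
theorem fourierInv_apply_eq_fourier_neg (Ψ : 𝓢(V, ℂ)) (z : V) :
    ((𝓕⁻ Ψ : 𝓢(V, ℂ)) : V → ℂ) z = (𝓕 Ψ) (-z) := by
  rw [SchwartzMap.fourierInv_coe, Real.fourierInv_eq_fourier_neg]
  rfl

/-- The Schwartz-level identity behind "Fourier multipliers with Schwartz symbol act by
convolution": `𝓕 (Ψ · 𝓕⁻ u) = u ⋆ 𝓕Ψ`, i.e. `𝓕 (Ψ · 𝓕⁻ u)(x) = ∫ u(y) (𝓕 Ψ)(x - y) dy`
(Mathlib's convolution theorem `SchwartzMap.fourier_convolution` read backwards through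
`𝓕 𝓕 = (-·)^*`). This is the twin, with the factors of the integrand commuted and an
independent proof, of `Literature.Analysis.FunctionSpaces.fourier_smulLeftCLM_fourierInv_apply` of `BMOBesovProofs.lean`, kept
here so that the Littlewood–Paley files do not import the `BMO` chain. [folklore] -/
theorem fourier_smulLeftCLM_fourierInv_apply_eq_integral (Ψ u : 𝓢(V, ℂ)) (x : V) :
    (𝓕 (SchwartzMap.smulLeftCLM ℂ (⇑Ψ) (𝓕⁻ u))) x = ∫ y, u y * (𝓕 Ψ) (x - y) := by
  have hΨ : (⇑Ψ).HasTemperateGrowth := Ψ.hasTemperateGrowth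
  have hc : SchwartzMap.convolution (ContinuousLinearMap.mul ℂ ℂ) u (𝓕 Ψ) =
      𝓕 (SchwartzMap.smulLeftCLM ℂ (⇑Ψ) (𝓕⁻ u)) := by
    calc SchwartzMap.convolution (ContinuousLinearMap.mul ℂ ℂ) u (𝓕 Ψ)
        = 𝓕⁻ (𝓕 (SchwartzMap.convolution (ContinuousLinearMap.mul ℂ ℂ) u (𝓕 Ψ))) := by
          rw [FourierTransform.fourierInv_fourier_eq]
      _ = 𝓕⁻ (SchwartzMap.pairing (ContinuousLinearMap.mul ℂ ℂ) (𝓕 u) (𝓕 (𝓕 Ψ))) := by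
          rw [SchwartzMap.fourier_convolution]
      _ = 𝓕⁻ (𝓕 (𝓕 (SchwartzMap.smulLeftCLM ℂ (⇑Ψ) (𝓕⁻ u)))) := by
          congr 1
          ext ξ
          rw [SchwartzMap.pairing_apply_apply, ContinuousLinearMap.mul_apply',
            fourier_fourier_apply, fourier_fourier_apply, SchwartzMap.smulLeftCLM_apply_apply hΨ,
            smul_eq_mul, fourierInv_apply_neg, mul_comm]
      _ = 𝓕 (SchwartzMap.smulLeftCLM ℂ (⇑Ψ) (𝓕⁻ u)) := by
          rw [FourierTransform.fourierInv_fourier_eq]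
  rw [← hc, SchwartzMap.convolution_apply, convolution_mul]

end SchwartzFourier

/-! ## Fourier multipliers with Schwartz symbol act on `L^p` by convolution -/

section MultiplierConvolution

variable {E F : Type*} [NormedAddCommGroup E] [InnerProductSpace ℝ E] [FiniteDimensional ℝ E]
  [MeasurableSpace E] [BorelSpace E] [NormedAddCommGroup F] [NormedSpace ℂ F]

/-- Translates of a Schwartz function lie in every `L^q`. [folklore] -/
theorem memLp_schwartz_sub (k : 𝓢(E, ℂ)) (q : ℝ≥0∞) (y : E) :
    MemLp (fun x => k (x - y)) q (volume : Measure E) :=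
  (k.memLp q (volume : Measure E)).comp_measurePreserving (measurePreserving_sub_right volume y)

/-- Translation invariance: `‖k(· - y)‖_{L^q} = ‖k‖_{L^q}`. [folklore] -/
theorem eLpNorm_schwartz_sub (k : 𝓢(E, ℂ)) (q : ℝ≥0∞) (y : E) :
    eLpNorm (fun x => k (x - y)) q (volume : Measure E) = eLpNorm (⇑k) q volume :=
  eLpNorm_comp_measurePreserving (g := (⇑k)) (k.continuous.aestronglyMeasurable)
    (measurePreserving_sub_right volume y)

/-- Hölder: for `f ∈ L^p` and Schwartz `k`, `x ↦ k(x - y) • f(x)` is integrable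
(`k(· - y) ∈ L^{p'}`). [folklore] -/
theorem integrable_schwartz_sub_smul_Lp {p : ℝ≥0∞} [hp : Fact (1 ≤ p)]
    (f : Lp F p (volume : Measure E)) (k : 𝓢(E, ℂ)) (y : E) :
    Integrable (fun x => k (x - y) • (f : E → F) x) (volume : Measure E) := by
  haveI : p.HolderConjugate (1 - p⁻¹)⁻¹ := ENNReal.HolderConjugate.inv_one_sub_inv' hp.out
  have := MemLp.smul (r := 1) (Lp.memLp f) (memLp_schwartz_sub k (1 - p⁻¹)⁻¹ y)
  exact memLp_one_iff_integrable.1 this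

/-- Hölder, quantitatively: `∫ ‖k(x - y) • f(x)‖ dx ≤ ‖k‖_{L^{p'}} ‖f‖_{L^p}` (a bound uniform in
`y`). [folklore] -/
theorem integral_norm_schwartz_sub_smul_Lp_le {p : ℝ≥0∞} [hp : Fact (1 ≤ p)]
    (f : Lp F p (volume : Measure E)) (k : 𝓢(E, ℂ)) (y : E) :
    ∫ x, ‖k (x - y) • (f : E → F) x‖ ≤
      (eLpNorm (⇑k) (1 - p⁻¹)⁻¹ volume * eLpNorm (f : E → F) p volume).toReal := by
  haveI : p.HolderConjugate (1 - p⁻¹)⁻¹ := ENNReal.HolderConjugate.inv_one_sub_inv' hp.out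
  have hf : MemLp (f : E → F) p volume := Lp.memLp f
  have hk := memLp_schwartz_sub k (1 - p⁻¹)⁻¹ y
  have hM_lt : eLpNorm (⇑k) (1 - p⁻¹)⁻¹ volume * eLpNorm (f : E → F) p volume < ∞ :=
    ENNReal.mul_lt_top (k.eLpNorm_lt_top ((1 - p⁻¹)⁻¹) volume) hf.eLpNorm_lt_top
  have hg : AEStronglyMeasurable (fun x => k (x - y) • (f : E → F) x) volume :=
    (integrable_schwartz_sub_smul_Lp f k y).aestronglyMeasurable
  have h1 : ∫⁻ x, ‖k (x - y) • (f : E → F) x‖ₑ ≤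
      eLpNorm (⇑k) (1 - p⁻¹)⁻¹ volume * eLpNorm (f : E → F) p volume :=
    calc ∫⁻ x, ‖k (x - y) • (f : E → F) x‖ₑ
        = eLpNorm (fun x => k (x - y) • (f : E → F) x) 1 volume :=
          eLpNorm_one_eq_lintegral_enorm.symm
      _ ≤ eLpNorm (fun x => k (x - y)) (1 - p⁻¹)⁻¹ volume * eLpNorm (f : E → F) p volume :=
          eLpNorm_smul_le_mul_eLpNorm hf.1 hk.1
      _ = eLpNorm (⇑k) (1 - p⁻¹)⁻¹ volume * eLpNorm (f : E → F) p volume := by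
          rw [eLpNorm_schwartz_sub]
  rw [integral_norm_eq_lintegral_enorm hg]
  exact ENNReal.toReal_mono hM_lt.ne h1

/-- The Fubini integrand `(x, y) ↦ (u(y) k(x - y)) • f(x)` is integrable on `E × E` for
`f ∈ L^p` and Schwartz `u`, `k` (slice-wise integrable by Hölder, with `y`-integral of the slice
norms at most `‖k‖_{p'} ‖f‖_p ∫ |u|`). [folklore] -/
theorem integrable_prod_schwartz_smul_Lp {p : ℝ≥0∞} [Fact (1 ≤ p)]
    (f : Lp F p (volume : Measure E)) (u k : 𝓢(E, ℂ)) :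
    Integrable (fun z : E × E => (u z.2 * k (z.1 - z.2)) • (f : E → F) z.1)
      ((volume : Measure E).prod volume) := by
  have hHm : AEStronglyMeasurable (fun z : E × E => (u z.2 * k (z.1 - z.2)) • (f : E → F) z.1)
      ((volume : Measure E).prod volume) := by
    have h1 : Continuous fun z : E × E => u z.2 * k (z.1 - z.2) := by fun_prop
    exact h1.aestronglyMeasurable.smul (Lp.aestronglyMeasurable f).comp_fst
  set M : ℝ := (eLpNorm (⇑k) (1 - p⁻¹)⁻¹ volume * eLpNorm (f : E → F) p volume).toReal with hM
  rw [integrable_prod_iff' hHm]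
  refine ⟨Eventually.of_forall fun y => ?_, ?_⟩
  · have h1 := (integrable_schwartz_sub_smul_Lp f k y).smul (u y)
    refine h1.congr (ae_of_all _ fun x => ?_)
    simp only [Pi.smul_apply, mul_smul]
  · refine Integrable.mono' (g := fun y => ‖u y‖ * M) ((u.integrable.norm).mul_const M)
      hHm.prod_swap.norm.integral_prod_right' (Eventually.of_forall fun y => ?_)
    rw [Real.norm_of_nonneg (integral_nonneg fun x => norm_nonneg _)]
    calc ∫ x, ‖(u y * k (x - y)) • (f : E → F) x‖
        = ∫ x, ‖u y‖ * ‖k (x - y) • (f : E → F) x‖ := by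
          refine integral_congr_ae (ae_of_all _ fun x => ?_)
          simp only [mul_smul, norm_smul]
      _ = ‖u y‖ * ∫ x, ‖k (x - y) • (f : E → F) x‖ := integral_const_mul _ _
      _ ≤ ‖u y‖ * M :=
          mul_le_mul_of_nonneg_left (integral_norm_schwartz_sub_smul_Lp_le f k y) (norm_nonneg _)

variable [CompleteSpace F]

/-- Fubini step: for `f ∈ L^p` and Schwartz `u`, `k`,
`∫ (∫ u(y) k(x - y) dy) • f(x) dx = ∫ u(y) • (∫ k(x - y) • f(x) dx) dy`. [folklore] -/
theorem integral_integral_smul_Lp_swap {p : ℝ≥0∞} [Fact (1 ≤ p)]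
    (f : Lp F p (volume : Measure E)) (u k : 𝓢(E, ℂ)) :
    ∫ x, (∫ y, u y * k (x - y)) • (f : E → F) x = ∫ y, u y • ∫ x, k (x - y) • (f : E → F) x := by
  have hHint := integrable_prod_schwartz_smul_Lp f u k
  calc ∫ x, (∫ y, u y * k (x - y)) • (f : E → F) x
      = ∫ x, ∫ y, (u y * k (x - y)) • (f : E → F) x := by
        refine integral_congr_ae (ae_of_all _ fun x => ?_)
        simp only
        rw [integral_smul_const]
    _ = ∫ y, ∫ x, (u y * k (x - y)) • (f : E → F) x :=
        integral_integral_swap (f := fun x y => (u y * k (x - y)) • (f : E → F) x) hHint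
    _ = ∫ y, u y • ∫ x, k (x - y) • (f : E → F) x := by
        refine integral_congr_ae (ae_of_all _ fun y => ?_)
        simp only [mul_smul]
        rw [integral_smul]

/-- **Fourier multipliers with Schwartz symbol act on `L^p` by convolution** (BCD §1.2 and the
proof of Lemma 2.1, `u = (𝓕⁻¹ψ) ⋆ u`): for `Ψ ∈ 𝓢(E, ℂ)`, `f ∈ L^p(E; F)`, `1 ≤ p ≤ ∞`, and every
test function `u`, `⟨Ψ(D) f, u⟩ = ∫ u(y) • ((𝓕⁻ Ψ) ⋆ f)(y) dy`, where `Ψ(D)` is Mathlib's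
`TemperedDistribution.fourierMultiplierCLM` and `⋆` Mathlib's convolution with `lsmul ℂ ℂ`. [folklore] -/
theorem fourierMultiplierCLM_coe_apply_eq_integral_convolution (Ψ : 𝓢(E, ℂ)) {p : ℝ≥0∞}
    [Fact (1 ≤ p)] (f : Lp F p (volume : Measure E)) (u : 𝓢(E, ℂ)) :
    fourierMultiplierCLM F (⇑Ψ) (f : 𝓢'(E, F)) u =
      ∫ y, u y • (((𝓕⁻ Ψ : 𝓢(E, ℂ)) : E → ℂ) ⋆[ContinuousLinearMap.lsmul ℂ ℂ, volume]
        (f : E → F)) y := by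
  rw [fourierMultiplierCLM_apply_apply, Lp.toTemperedDistribution_apply]
  have hw : ∀ x, (𝓕 (SchwartzMap.smulLeftCLM ℂ (⇑Ψ) (𝓕⁻ u))) x = ∫ y, u y * (𝓕 Ψ) (x - y) :=
    fourier_smulLeftCLM_fourierInv_apply_eq_integral Ψ u
  simp_rw [hw, integral_integral_smul_Lp_swap f u (𝓕 Ψ), convolution_lsmul_swap,
    fourierInv_apply_eq_fourier_neg, neg_sub]

end MultiplierConvolution

/-! ## The dyadic symbols: support, and the reproducing symbol `ψ` of `Δ̇₀` -/

section Symbols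

variable {E : Type*} [NormedAddCommGroup E] [InnerProductSpace ℝ E]

/-- `‖2^a • ξ‖ = 2^a ‖ξ‖`. [folklore] -/
theorem norm_two_zpow_smul (a : ℤ) (ξ : E) : ‖((2 : ℝ) ^ a) • ξ‖ = (2 : ℝ) ^ a * ‖ξ‖ := by
  rw [norm_smul, Real.norm_of_nonneg (zpow_nonneg zero_le_two _)]

/-- Discharge of the named fact `dyadicSymbol_apply_of_norm_le` (BCD Prop. 2.10): `φ_j` vanishes
on `‖ξ‖ ≤ 2^{j-1}`, since there `‖2^{-j}ξ‖ ≤ 1/2` and `‖2^{1-j}ξ‖ ≤ 1`, so both cut-offs are `1`. [cite: BahouriCheminDanchin2011, Prop. 2.10] -/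
theorem dyadicSymbol_apply_of_norm_le_holds : dyadicSymbol_apply_of_norm_le (E := E) := by
  intro j ξ h
  have h2 : (0 : ℝ) < 2 := two_pos
  simp only [dyadicSymbol]
  rw [dyadicCutoff_apply_of_norm_le_one, dyadicCutoff_apply_of_norm_le_one, sub_self,
    Complex.ofReal_zero]
  · rw [norm_two_zpow_smul]
    calc (2 : ℝ) ^ (1 - j) * ‖ξ‖ ≤ (2 : ℝ) ^ (1 - j) * (2 : ℝ) ^ (j - 1) :=
          mul_le_mul_of_nonneg_left h (zpow_nonneg h2.le _)
      _ = 1 := by rw [← zpow_add₀ h2.ne']; norm_num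
  · rw [norm_two_zpow_smul]
    calc (2 : ℝ) ^ (-j) * ‖ξ‖ ≤ (2 : ℝ) ^ (-j) * (2 : ℝ) ^ (j - 1) :=
          mul_le_mul_of_nonneg_left h (zpow_nonneg h2.le _)
      _ = (2 : ℝ) ^ (-1 : ℤ) := by rw [← zpow_add₀ h2.ne']; congr 1; ring
      _ ≤ 1 := by norm_num

/-- Discharge of the named fact `dyadicSymbol_apply_of_le_norm` (BCD Prop. 2.10): `φ_j` vanishes
on `2^{j+1} ≤ ‖ξ‖`, since there `2 ≤ ‖2^{-j}ξ‖` and `4 ≤ ‖2^{1-j}ξ‖`, so both cut-offs vanish. [cite: BahouriCheminDanchin2011, Prop. 2.10] -/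
theorem dyadicSymbol_apply_of_le_norm_holds : dyadicSymbol_apply_of_le_norm (E := E) := by
  intro j ξ h
  have h2 : (0 : ℝ) < 2 := two_pos
  simp only [dyadicSymbol]
  rw [dyadicCutoff_apply_of_two_le_norm, dyadicCutoff_apply_of_two_le_norm, sub_self,
    Complex.ofReal_zero]
  · rw [norm_two_zpow_smul]
    calc (2 : ℝ) = (2 : ℝ) ^ (1 - j) * (2 : ℝ) ^ (j + 1) / 2 := by
          rw [← zpow_add₀ h2.ne']; ring_nf; norm_num
      _ ≤ (2 : ℝ) ^ (1 - j) * (2 : ℝ) ^ (j + 1) := by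
          apply div_le_self (by positivity) one_le_two
      _ ≤ (2 : ℝ) ^ (1 - j) * ‖ξ‖ := mul_le_mul_of_nonneg_left h (zpow_nonneg h2.le _)
  · rw [norm_two_zpow_smul]
    calc (2 : ℝ) = (2 : ℝ) ^ (-j) * (2 : ℝ) ^ (j + 1) := by
          rw [← zpow_add₀ h2.ne', show -j + (j + 1) = 1 by ring, zpow_one]
      _ ≤ (2 : ℝ) ^ (-j) * ‖ξ‖ := mul_le_mul_of_nonneg_left h (zpow_nonneg h2.le _)

/-- The **reproducing symbol** of the block `Δ̇₀`: `ψ(ξ) = χ(ξ/2) - χ(4ξ)`, i.e. the symbol of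
`Ṡ₁ - Ṡ₋₂ = Δ̇₋₁ + Δ̇₀ + Δ̇₁`; it equals `1` on the closed annulus `1/2 ≤ ‖ξ‖ ≤ 2`, which contains
`{φ₀ ≠ 0}`; all that is used below is `φ₀ ψ = φ₀` (`dyadicSymbol_zero_mul_bernsteinSymbol`)
(BCD, proof of Lemma 2.1: "a function `ψ` of `𝓓` with value `1` near the annulus `𝒞`"). [folklore] -/
def bernsteinSymbol (ξ : E) : ℂ := lowFreqSymbol 1 ξ - lowFreqSymbol (-2) ξ

/-- `ψ = Ṡ₁`-symbol `- Ṡ₋₂`-symbol, as functions. [folklore] -/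
theorem bernsteinSymbol_eq : (bernsteinSymbol : E → ℂ) = lowFreqSymbol 1 - lowFreqSymbol (-2) :=
  rfl

/-- `ψ = 1` on the closed annulus `1/2 ≤ ‖ξ‖ ≤ 2` (there `‖ξ/2‖ ≤ 1` and `‖4ξ‖ ≥ 2`). [folklore] -/
theorem bernsteinSymbol_eq_one {ξ : E} (h₁ : 2⁻¹ ≤ ‖ξ‖) (h₂ : ‖ξ‖ ≤ 2) : bernsteinSymbol ξ = 1 := by
  simp only [bernsteinSymbol, lowFreqSymbol]
  rw [dyadicCutoff_apply_of_norm_le_one, dyadicCutoff_apply_of_two_le_norm]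
  · simp
  · rw [norm_two_zpow_smul, neg_neg]
    calc (2 : ℝ) = (2 : ℝ) ^ (2 : ℤ) * 2⁻¹ := by norm_num
      _ ≤ (2 : ℝ) ^ (2 : ℤ) * ‖ξ‖ := mul_le_mul_of_nonneg_left h₁ (by norm_num)
  · rw [norm_two_zpow_smul]
    calc (2 : ℝ) ^ (-1 : ℤ) * ‖ξ‖ ≤ (2 : ℝ) ^ (-1 : ℤ) * 2 :=
          mul_le_mul_of_nonneg_left h₂ (by norm_num)
      _ = 1 := by norm_num

/-- `φ₀ ψ = φ₀`: the reproducing symbol is `1` wherever the dyadic symbol `φ₀` is nonzero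
(`supp φ₀ ⊆ {1/2 < ‖ξ‖ < 2}` by the two support facts). [folklore] -/
theorem dyadicSymbol_zero_mul_bernsteinSymbol :
    (dyadicSymbol 0 : E → ℂ) * bernsteinSymbol = dyadicSymbol 0 := by
  funext ξ
  simp only [Pi.mul_apply]
  rcases le_or_gt ‖ξ‖ 2⁻¹ with h | h
  · rw [dyadicSymbol_apply_of_norm_le_holds (j := 0) (by simpa using h), zero_mul]
  rcases le_or_gt 2 ‖ξ‖ with h' | h'
  · rw [dyadicSymbol_apply_of_le_norm_holds (j := 0) (by simpa using h'), zero_mul]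
  rw [bernsteinSymbol_eq_one h.le h'.le, mul_one]

/-- `ψ` is smooth. [folklore] -/
theorem contDiff_bernsteinSymbol : ContDiff ℝ (⊤ : ℕ∞) (bernsteinSymbol : E → ℂ) := by
  rw [bernsteinSymbol_eq]
  exact (contDiff_lowFreqSymbol 1).sub (contDiff_lowFreqSymbol (-2))

variable [FiniteDimensional ℝ E]

/-- `ψ` has compact support (contained in `‖ξ‖ ≤ 4`). [folklore] -/
theorem hasCompactSupport_bernsteinSymbol : HasCompactSupport (bernsteinSymbol : E → ℂ) := by
  rw [bernsteinSymbol_eq]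
  exact (hasCompactSupport_lowFreqSymbol 1).sub (hasCompactSupport_lowFreqSymbol (-2))

/-- `ψ` has temperate growth (so that `ψ(D)` is an honest Fourier multiplier). [folklore] -/
theorem hasTemperateGrowth_bernsteinSymbol : (bernsteinSymbol : E → ℂ).HasTemperateGrowth := by
  rw [bernsteinSymbol_eq]
  exact (hasTemperateGrowth_lowFreqSymbol 1).sub (hasTemperateGrowth_lowFreqSymbol (-2))

variable (E) in
/-- `ψ` as a Schwartz function (smooth with compact support). [folklore] -/
def bernsteinSchwartz : 𝓢(E, ℂ) :=
  hasCompactSupport_bernsteinSymbol.toSchwartzMap contDiff_bernsteinSymbol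

/-- The Schwartz function `bernsteinSchwartz` is the symbol `ψ`. [folklore] -/
@[simp]
theorem coe_bernsteinSchwartz : ((bernsteinSchwartz E : 𝓢(E, ℂ)) : E → ℂ) = bernsteinSymbol :=
  rfl

variable {F : Type*} [MeasurableSpace E] [BorelSpace E] [NormedAddCommGroup F] [NormedSpace ℂ F]

/-- `Δ̇₀ = ψ(D) Δ̇₀` on `𝓢'(E, F)`: composing Fourier multipliers multiplies the symbols
(`TemperedDistribution.fourierMultiplierCLM_fourierMultiplierCLM_apply`, temperate growth of both
symbols proved) and `φ₀ ψ = φ₀` (BCD, proof of Lemma 2.1: `û = ψ û`). [folklore] -/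
theorem lpBlock_zero_eq_fourierMultiplierCLM_bernsteinSymbol (u : 𝓢'(E, F)) :
    lpBlock 0 u = fourierMultiplierCLM F (bernsteinSymbol : E → ℂ) (lpBlock 0 u) := by
  rw [lpBlock_apply, fourierMultiplierCLM_fourierMultiplierCLM_apply (hasTemperateGrowth_dyadicSymbol 0)
    hasTemperateGrowth_bernsteinSymbol, dyadicSymbol_zero_mul_bernsteinSymbol]

end Symbols

/-! ## Bernstein's inequality on the dyadic blocks and the Besov embedding -/

section Bernstein

variable {E F : Type*} [NormedAddCommGroup E] [InnerProductSpace ℝ E] [FiniteDimensional ℝ E]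
  [MeasurableSpace E] [BorelSpace E] [NormedAddCommGroup F] [NormedSpace ℂ F] [CompleteSpace F]

variable (E) in
/-- The **Bernstein kernel** `h = 𝓕⁻ ψ ∈ 𝓢(E, ℂ)` of the reproducing symbol `ψ`
(BCD, proof of Lemma 2.1: `u = h ⋆ u` with `h = 𝓕⁻¹ψ` when `supp û ⊂ 𝒞`). [folklore] -/
def bernsteinKernel : 𝓢(E, ℂ) := 𝓕⁻ (bernsteinSchwartz E : 𝓢(E, ℂ))

/-- **Bernstein's inequality at frequency `1`** (BCD Lemma 2.1 with `λ = 1`, `k = 0`): for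
`1 ≤ p ≤ r ≤ ∞` there is `C ≠ 0` with `‖Δ̇₀ v‖_{L^r} ≤ C ‖Δ̇₀ v‖_{L^p}` for every `v ∈ 𝓢'(E, F)`:
if `Δ̇₀ v = f ∈ L^p` then `Δ̇₀ v = ψ(D) f = h ⋆ f ∈ L^r` with `‖h ⋆ f‖_r ≤ C ‖f‖_p`
(`exists_eLpNorm_convolution_smul_le`); if `Δ̇₀ v ∉ L^p` the right-hand side is `∞` (as `C ≠ 0`),
so the bound holds vacuously. [cite: BahouriCheminDanchin2011, Lemma 2.1] -/
theorem exists_eLpNormDistrib_lpBlock_zero_le (p r : ℝ≥0∞) [hp : Fact (1 ≤ p)] [Fact (1 ≤ r)]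
    (hpr : p ≤ r) :
    ∃ C : ℝ≥0, C ≠ 0 ∧ ∀ v : 𝓢'(E, F),
      eLpNormDistrib r (lpBlock 0 v) ≤ C * eLpNormDistrib p (lpBlock 0 v) := by
  haveI : p.HolderConjugate (1 - p⁻¹)⁻¹ := ENNReal.HolderConjugate.inv_one_sub_inv' hp.out
  have hK : AEStronglyMeasurable (⇑(bernsteinKernel E)) (volume : Measure E) :=
    (bernsteinKernel E).continuous.aestronglyMeasurable
  obtain ⟨C, hC⟩ := exists_eLpNorm_convolution_smul_le (F := F) (μ := (volume : Measure E)) hK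
    ((bernsteinKernel E).eLpNorm_lt_top 1 volume)
    ((bernsteinKernel E).eLpNorm_lt_top ((1 - p⁻¹)⁻¹) volume) hpr
  refine ⟨max C 1, (lt_max_of_lt_right one_pos).ne', fun v => ?_⟩
  by_cases h : ∃ f : Lp F p (volume : Measure E), (f : 𝓢'(E, F)) = lpBlock 0 v
  · obtain ⟨f, hf⟩ := h
    have hfm : AEStronglyMeasurable (f : E → F) volume := Lp.aestronglyMeasurable f
    have hg : MemLp ((⇑(bernsteinKernel E)) ⋆[ContinuousLinearMap.lsmul ℂ ℂ, volume] (f : E → F))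
        r volume :=
      ⟨aestronglyMeasurable_convolution_smul hK hfm, (hC _ hfm).trans_lt
        (ENNReal.mul_lt_top ENNReal.coe_lt_top (Lp.memLp f).eLpNorm_lt_top)⟩
    -- `Δ̇₀ v = ψ(D) f = h ⋆ f` as distributions
    have hrep : ((hg.toLp _ : Lp F r (volume : Measure E)) : 𝓢'(E, F)) = lpBlock 0 v := by
      rw [lpBlock_zero_eq_fourierMultiplierCLM_bernsteinSymbol, ← hf, ← coe_bernsteinSchwartz]
      ext u
      rw [Lp.toTemperedDistribution_apply, fourierMultiplierCLM_coe_apply_eq_integral_convolution]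
      refine integral_congr_ae ?_
      filter_upwards [hg.coeFn_toLp] with y hy
      rw [hy]
      rfl
    calc eLpNormDistrib r (lpBlock 0 v)
        ≤ ‖(hg.toLp _ : Lp F r (volume : Measure E))‖ₑ := by
          rw [← hrep]; exact eLpNormDistrib_coe_le _
      _ = eLpNorm ((⇑(bernsteinKernel E)) ⋆[ContinuousLinearMap.lsmul ℂ ℂ, volume] (f : E → F))
            r volume := Lp.enorm_toLp hg
      _ ≤ C * eLpNorm (f : E → F) p volume := hC _ hfm
      _ ≤ ((max C 1 : ℝ≥0) : ℝ≥0∞) * eLpNorm (f : E → F) p volume := by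
          gcongr
          exact le_max_left _ _
      _ = ((max C 1 : ℝ≥0) : ℝ≥0∞) * eLpNormDistrib p (lpBlock 0 v) := by
          rw [← hf, eLpNormDistrib_coe, Lp.enorm_def]
  · push Not at h
    rw [eLpNormDistrib_of_forall_ne h, ENNReal.mul_top (by simp)]
    exact le_top

/-- `2^a · 2^b = 2^{a+b}` in `ℝ≥0∞` (real exponents). [folklore] -/
theorem two_rpow_mul_two_rpow (a b : ℝ) :
    (2 : ℝ≥0∞) ^ a * (2 : ℝ≥0∞) ^ b = (2 : ℝ≥0∞) ^ (a + b) :=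
  (ENNReal.rpow_add a b two_ne_zero ENNReal.ofNat_ne_top).symm

/-- **Bernstein's inequality on the dyadic blocks** (BCD Lemma 2.1, `k = 0`, `λ = 2^j`, derived
from frequency `1` by the dyadic scaling `Δ̇_j u = (Δ̇₀ (u(2^{-j}·)))(2^j ·)` and
`‖w(2^j ·)‖_{L^p} = 2^{-jd/p} ‖w‖_{L^p}`): for `1 ≤ p ≤ r ≤ ∞` there is `C ≠ 0` such that for every
`j ∈ ℤ` and `u ∈ 𝓢'(E, F)`, `‖Δ̇_j u‖_{L^r} ≤ C 2^{j d (1/p - 1/r)} ‖Δ̇_j u‖_{L^p}`, `d = dim E`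
(`1/∞ = 0` through `(∞ : ℝ≥0∞).toReal⁻¹ = 0`). [cite: BahouriCheminDanchin2011, Lemma 2.1] -/
theorem exists_eLpNormDistrib_lpBlock_le (p r : ℝ≥0∞) [Fact (1 ≤ p)] [Fact (1 ≤ r)]
    (hpr : p ≤ r) :
    ∃ C : ℝ≥0, C ≠ 0 ∧ ∀ (j : ℤ) (u : 𝓢'(E, F)),
      eLpNormDistrib r (lpBlock j u) ≤
        C * (2 : ℝ≥0∞) ^ ((j : ℝ) * Module.finrank ℝ E * (p.toReal⁻¹ - r.toReal⁻¹)) *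
          eLpNormDistrib p (lpBlock j u) := by
  obtain ⟨C, hC0, hC⟩ := exists_eLpNormDistrib_lpBlock_zero_le (E := E) (F := F) p r hpr
  refine ⟨C, hC0, fun j u => ?_⟩
  set c : ℝˣ := Units.mk0 ((2 : ℝ) ^ j) (zpow_ne_zero j two_ne_zero) with hc
  set w : 𝓢'(E, F) := distribDilate c⁻¹ u
  have hu : u = distribDilate c w := (distribDilate_distribDilate_inv c u).symm
  have hblock : lpBlock j u = distribDilate c (lpBlock 0 w) := by
    conv_lhs => rw [hu, hc, lpBlock_distribDilate_holds j j w, sub_self]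
  have hr : eLpNormDistrib r (lpBlock j u) =
      (2 : ℝ≥0∞) ^ (-((j : ℝ) * Module.finrank ℝ E) / r.toReal) * eLpNormDistrib r (lpBlock 0 w) := by
    rw [hblock, eLpNormDistrib_distribDilate, hc, Units.val_mk0, dilateConst_two_zpow]
  have hp : eLpNormDistrib p (lpBlock j u) =
      (2 : ℝ≥0∞) ^ (-((j : ℝ) * Module.finrank ℝ E) / p.toReal) * eLpNormDistrib p (lpBlock 0 w) := by
    rw [hblock, eLpNormDistrib_distribDilate, hc, Units.val_mk0, dilateConst_two_zpow]
  rw [hr, hp]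
  calc (2 : ℝ≥0∞) ^ (-((j : ℝ) * Module.finrank ℝ E) / r.toReal) * eLpNormDistrib r (lpBlock 0 w)
      ≤ (2 : ℝ≥0∞) ^ (-((j : ℝ) * Module.finrank ℝ E) / r.toReal) *
          (C * eLpNormDistrib p (lpBlock 0 w)) := by
        gcongr
        exact hC w
    _ = C * ((2 : ℝ≥0∞) ^ ((j : ℝ) * Module.finrank ℝ E * (p.toReal⁻¹ - r.toReal⁻¹)) *
          (2 : ℝ≥0∞) ^ (-((j : ℝ) * Module.finrank ℝ E) / p.toReal)) *
          eLpNormDistrib p (lpBlock 0 w) := by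
        rw [two_rpow_mul_two_rpow,
          show (j : ℝ) * Module.finrank ℝ E * (p.toReal⁻¹ - r.toReal⁻¹) +
              -((j : ℝ) * Module.finrank ℝ E) / p.toReal =
            -((j : ℝ) * Module.finrank ℝ E) / r.toReal by ring]
        ring
    _ = C * (2 : ℝ≥0∞) ^ ((j : ℝ) * Module.finrank ℝ E * (p.toReal⁻¹ - r.toReal⁻¹)) *
          ((2 : ℝ≥0∞) ^ (-((j : ℝ) * Module.finrank ℝ E) / p.toReal) *
            eLpNormDistrib p (lpBlock 0 w)) := by ring

/-- The Besov weights under Bernstein's inequality: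
`2^{j(s - d(1/p - 1/r))} ‖Δ̇_j u‖_{L^r} ≤ C 2^{js} ‖Δ̇_j u‖_{L^p}` (BCD, proof of Prop. 2.20). [cite: BahouriCheminDanchin2011, Prop. 2.20] -/
theorem lpBlockWeight_exponent_le {p r : ℝ≥0∞} [Fact (1 ≤ p)] [Fact (1 ≤ r)] {C : ℝ≥0}
    (hC : ∀ (j : ℤ) (u : 𝓢'(E, F)), eLpNormDistrib r (lpBlock j u) ≤
        C * (2 : ℝ≥0∞) ^ ((j : ℝ) * Module.finrank ℝ E * (p.toReal⁻¹ - r.toReal⁻¹)) *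
          eLpNormDistrib p (lpBlock j u))
    (s : ℝ) (u : 𝓢'(E, F)) (j : ℤ) :
    lpBlockWeight (s - Module.finrank ℝ E * (p.toReal⁻¹ - r.toReal⁻¹)) r u j ≤
      C * lpBlockWeight s p u j := by
  simp only [lpBlockWeight]
  calc (2 : ℝ≥0∞) ^ ((j : ℝ) * (s - Module.finrank ℝ E * (p.toReal⁻¹ - r.toReal⁻¹))) *
        eLpNormDistrib r (lpBlock j u)
      ≤ (2 : ℝ≥0∞) ^ ((j : ℝ) * (s - Module.finrank ℝ E * (p.toReal⁻¹ - r.toReal⁻¹))) *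
          (C * (2 : ℝ≥0∞) ^ ((j : ℝ) * Module.finrank ℝ E * (p.toReal⁻¹ - r.toReal⁻¹)) *
            eLpNormDistrib p (lpBlock j u)) := by
        gcongr
        exact hC j u
    _ = C * ((2 : ℝ≥0∞) ^ ((j : ℝ) * (s - Module.finrank ℝ E * (p.toReal⁻¹ - r.toReal⁻¹))) *
          (2 : ℝ≥0∞) ^ ((j : ℝ) * Module.finrank ℝ E * (p.toReal⁻¹ - r.toReal⁻¹))) *
          eLpNormDistrib p (lpBlock j u) := by ring
    _ = C * ((2 : ℝ≥0∞) ^ ((j : ℝ) * s) * eLpNormDistrib p (lpBlock j u)) := by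
        rw [two_rpow_mul_two_rpow,
          show (j : ℝ) * (s - Module.finrank ℝ E * (p.toReal⁻¹ - r.toReal⁻¹)) +
            (j : ℝ) * Module.finrank ℝ E * (p.toReal⁻¹ - r.toReal⁻¹) = (j : ℝ) * s by ring]
        ring

/-- Discharge of the named fact `besov_embedding` (BCD Prop. 2.20): for `1 ≤ p ≤ r ≤ ∞`,
`s ∈ ℝ`, `q ∈ [0, ∞]` there is `C` with `‖u‖_{Ḃ^{s - d(1/p - 1/r)}_{r,q}} ≤ C ‖u‖_{Ḃ^s_{p,q}}` for
all `u ∈ 𝓢'(E, F)` — Bernstein's inequality on each block (`exists_eLpNormDistrib_lpBlock_le`),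
then monotonicity and homogeneity of the `ℓ^q(ℤ)` norm
(`MeasureTheory.eLpNorm_le_mul_eLpNorm_of_ae_le_mul'` for the counting measure). [cite: BahouriCheminDanchin2011, Prop. 2.20] -/
theorem besov_embedding_holds : besov_embedding (E := E) (F := F) := by
  intro s p r _ _ hpr q
  obtain ⟨C, -, hC⟩ := exists_eLpNormDistrib_lpBlock_le (E := E) (F := F) p r hpr
  refine ⟨C, fun u => ?_⟩
  unfold eHomBesovNorm
  refine eLpNorm_le_mul_eLpNorm_of_ae_le_mul' (ae_of_all _ fun j => ?_) q
  simpa only [enorm_eq_self] using lpBlockWeight_exponent_le hC s u j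

/-- Discharge of the named fact `MemHomBesov.of_exponent_le` (BCD Prop. 2.20 at the level of
classes): `Ḃ^s_{p,q} ⊂ Ḃ^{s - d(1/p - 1/r)}_{r,q}` for `p ≤ r` — finite norm by
`besov_embedding_holds`, while the realisation condition `Ṡ_j u → 0` (`j → -∞`) does not depend
on the indices. [cite: BahouriCheminDanchin2011, Prop. 2.20] -/
theorem MemHomBesov.of_exponent_le_holds : MemHomBesov.of_exponent_le (E := E) (F := F) := by
  intro s p r q _ _ hpr u h
  obtain ⟨C, hC⟩ := besov_embedding_holds (E := E) (F := F) s hpr q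
  exact ⟨(hC u).trans_lt (ENNReal.mul_lt_top ENNReal.coe_lt_top h.1), h.2⟩

end Bernstein

end Literature.Analysis.FunctionSpaces
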